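import Mathlib.Analysis.Calculus.ContDiff.Defs
import Mathlib.Analysis.InnerProductSpace.PiL2
import Mathlib.Analysis.Complex.Basic
import HarnessLib

/-!
# Unique continuation from an open set for flat `J`-holomorphic curves in `ℝ⁴` (Aronszajn / Carleman)

A NAMED FACT of first-order elliptic PDE in two variables, the coordinate form of the unique
continuation used everywhere in the local theory of `J`-holomorphic curves:

* `Literature.Geometry.Symplectic.jHolomorphicFlat_uniqueContinuation_const` — let `Jc` be a
  `C^∞` field of complex structures (`Jc(y)² = −1`) on an open set `T ⊆ ℝ⁴` and `u` a `C^∞` map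
  from a disc `ball c r ⊆ ℂ` into `T` which is `Jc`-holomorphic in the flat sense,
  `Du(z)(iζ) = Jc(u z)(Du(z) ζ)` (the tree's `IsJHolomorphicFlat`, written pointwise on the disc);
  if `u` is constant on a neighbourhood of one point of the disc then it is constant on the disc.

Source: D. McDuff, JDG 34 (1991), Lemma 2.3 p. 147: two `J`-holomorphic curves with the same
`∞`-jet at a point of a connected Riemann surface coincide — proof: in coordinates (Corollary 2.2)
the difference `g` satisfies the differential inequalities (2.3.1)
`|∂∂̄ gᵐ| ≤ M Σ (|gᵐ| + |∂gᵐ| + |∂̄gᵐ|)`, "In this situation, Aronszajn's strong unique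
continuation theorem [1, Remark 3] implies that `g` is identically zero" (N. Aronszajn, J. Math.
Pures Appl. 36 (1957)); applied to `u` and the constant curve, then propagated over the
(connected) disc. Equivalently Wendl, *Lectures on holomorphic curves*, Prop. 2.54 (via the
similarity principle); historically T. Carleman (1939) for first-order elliptic systems in two
variables.

Consumed by `jHolomorphic_uniqueContinuation_const` (the manifold form, fact F1 of
`JHolomorphicLocalIntersections.lean`), which is PROVED from this flat form on the Summits side
(chart localisation of `J`-holomorphic maps + a clopen argument on the locally-constant locus).
Design: stated on a disc with the curve confined to the open set `T` carrying `Jc` (the chart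
target); `C^∞` data (the consumers have it; Carleman's theorem needs much less). Deliberately NOT
here: the strong (infinite-order) form, the similarity principle, anything about two curves.
-/

noncomputable section

open scoped ContDiff
open Set Filter Topology

namespace Literature.Geometry.Symplectic

/-- **Unique continuation from an open set for flat `J`-holomorphic curves (McDuff 1991
Lemma 2.3 via Aronszajn 1957; Carleman 1939).** Let `T ⊆ ℝ⁴` be open, `Jc : ℝ⁴ → End(ℝ⁴)` of
class `C^∞` on `T` with `Jc(y)² = −1` for `y ∈ T`, and `u : ℂ → ℝ⁴` of class `C^∞` on the disc
`ball c r`, mapping it into `T`, and `Jc`-holomorphic there: `Du(z)(iζ) = Jc(u z)(Du(z) ζ)` for all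
`z ∈ ball c r`, `ζ ∈ ℂ`. If `u` is constant on a neighbourhood of some `z₀ ∈ ball c r`, then
`u z = u z₀` for every `z ∈ ball c r`. (In coordinates `u − u z₀ =: g` solves a first-order
elliptic system, hence `|∂∂̄g| ≤ M(|g| + |∂g| + |∂̄g|)` (McDuff (2.3.1)), and vanishes to infinite
order at the boundary points of the open set where it vanishes; Aronszajn's theorem and the
connectedness of the disc conclude.)
[cite: McDuff1991LocalBehaviour, Lemma 2.3 and (2.3.1)] -/
def jHolomorphicFlat_uniqueContinuation_const : Prop :=
  ∀ (T : Set (EuclideanSpace ℝ (Fin 4))), IsOpen T →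
  ∀ (Jc : EuclideanSpace ℝ (Fin 4) → EuclideanSpace ℝ (Fin 4) →L[ℝ] EuclideanSpace ℝ (Fin 4)),
    ContDiffOn ℝ ∞ Jc T →
    (∀ y ∈ T, ∀ v : EuclideanSpace ℝ (Fin 4), Jc y (Jc y v) = -v) →
  ∀ (c : ℂ) (r : ℝ), 0 < r →
  ∀ (u : ℂ → EuclideanSpace ℝ (Fin 4)), ContDiffOn ℝ ∞ u (Metric.ball c r) →
    Set.MapsTo u (Metric.ball c r) T →
    (∀ z ∈ Metric.ball c r, ∀ ζ : ℂ,
      fderiv ℝ u z (Complex.I * ζ) = Jc (u z) (fderiv ℝ u z ζ)) →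
    ∀ z₀ ∈ Metric.ball c r, (∀ᶠ z in 𝓝 z₀, u z = u z₀) →
      ∀ z ∈ Metric.ball c r, u z = u z₀

end Literature.Geometry.Symplectic
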